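import Mathlib
import Literature.Combinatorics.Additive.TripleProductProperty
import Literature.Barriers.MatrixMultiplication.QuasirandomBarrier
import Literature.Barriers.MatrixMultiplication.QuasirandomBarrierProofs
import Literature.Barriers.MatrixMultiplication.YoungSubgroupBarrierSTPP
import Summits.MatrixMultiplication.MatrixMultiplication.Theorems.GradedDesignFamily.Negative.SlicedHorn

/-!
# `GradedDesignFamily` (stmt-MatrixMultiplication-7610), line `quadratic-extension-level-one-cell`:
# TPP triples supported on cosets of ONE subgroup are capped by that subgroup's quasirandomness
# (negative-side support for `stub_subfieldCell`: the "subgroup horns", lead c2)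

Generalisation of `Negative/SlicedHorn.lean` from the determinant-one slice to an arbitrary subgroup
`M ≤ G`: if `(X, Y, Z)` has the triple product property in `G`, `X ⊆ M`, and `Y` (resp. `Z`) lies in a
single right coset of `M` — equivalently `y y'⁻¹ ∈ M` for all `y, y' ∈ Y` (resp. `z z'⁻¹ ∈ M`) — then

  `|X||Y||Z| ≤ |M|^{3/2}/√n(M) + |M|`,   `n(M) = secondCharDegree M`

(`subgroupHorn_card_mul_le`; right-translate `Y`, `Z` into `M` — the TPP only sees right quotients,
`tripleProductProperty_image_mul_right_iff` — pull back along the injective hom `M.subtype`, and apply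
BCGPU 2023 Thm 3.2, `BCGPU2023_thm32_holds`, inside `M`), and the same with `X` replaced by `X ∩ M`
for an arbitrary `X` (`subgroupHorn_card_filter_mul_le`, by `TripleProductProperty.mono`).  Use for the
closer `stub_subfieldCell` (lead's assessment §2bis, `Cruxes/GradedDesignFamily/Lines/…-S3.md`): the
S-parts of a level-one design whose det-class parts sit in cosets of a common proper subgroup
`M < SL₂(K)` are capped class pair by class pair; for the Borel `M = B(K)` (the only placement with a
small `SL₂(k)`-coset footprint), `X ∩ M = B(k)` and `n(B(K)) = (|K|−1)/gcd(2,|K|−1)` give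
`|Ȳ_a||Z̄_b| ≲ |K|^{3/2}`, killing every PRODUCT design in the Borel horn.

Sorry-free; axioms `propext`, `Classical.choice`, `Quot.sound`.
-/

set_option linter.dupNamespace false

noncomputable section

open scoped BigOperators
open Literature.Combinatorics.Additive Literature.Barriers.MatrixMultiplication

namespace Summit.MatrixMultiplication.MatrixMultiplication.Theorems.GradedDesignFamily.Negative

/-- Pull-back of a finite subset of a subgroup `M` to a finset of `↥M`: same image, same cardinality.
[folklore] -/
theorem subgroupHorn_exists_preimage {G : Type} [Group G] [DecidableEq G] (M : Subgroup G)
    (X : Finset G) (hX : ∀ x ∈ X, x ∈ M) :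
    ∃ X' : Finset M, X'.image M.subtype = X ∧ X'.card = X.card := by
  classical
  refine ⟨X.subtype (· ∈ M), ?_, ?_⟩
  · ext g
    simp only [Finset.mem_image, Finset.mem_subtype, Subgroup.coe_subtype]
    constructor
    · rintro ⟨a, ha, rfl⟩; exact ha
    · intro hg; exact ⟨⟨g, hX g hg⟩, hg, rfl⟩
  · rw [Finset.card_subtype]
    congr 1
    exact Finset.filter_true_of_mem hX

/-- **Subgroup horns are capped by the subgroup's quasirandomness.**  Let `M ≤ G` be a nonabelian
subgroup of a finite group.  If `(X, Y, Z)` has the triple product property in `G`, `X ⊆ M`, and `Y`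
and `Z` each lie in one right coset of `M` (`y y'⁻¹ ∈ M`, `z z'⁻¹ ∈ M`), then
`|X||Y||Z| ≤ |M|^{3/2}/√n(M) + |M|` with `n(M)` the second-smallest character degree of `M`
(BCGPU 2023, Thm 3.2, applied inside `M`). [cite: BlasiakCohnGrochowPrattUmans2023, Thm. 3.2] -/
theorem subgroupHorn_card_mul_le {G : Type} [Group G] [Fintype G] [DecidableEq G] (M : Subgroup G)
    (X Y Z : Finset G) (hT : Literature.Combinatorics.Additive.TripleProductProperty X Y Z)
    (hX : ∀ x ∈ X, x ∈ M) (hY : ∀ y ∈ Y, ∀ y' ∈ Y, y * y'⁻¹ ∈ M) (hZ : ∀ z ∈ Z, ∀ z' ∈ Z, z * z'⁻¹ ∈ M)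
    (hna : ∃ a b : M, a * b ≠ b * a) :
    ((X.card * Y.card * Z.card : ℕ) : ℝ) ≤
      (Nat.card M : ℝ) ^ (3 / 2 : ℝ) / Real.sqrt (Literature.Barriers.MatrixMultiplication.secondCharDegree M) +
        Nat.card M := by
  classical
  have hcardM : (Nat.card M : ℝ) = Fintype.card M := by rw [Nat.card_eq_fintype_card]
  have hRHS : (0 : ℝ) ≤ (Nat.card M : ℝ) ^ (3 / 2 : ℝ) / Real.sqrt (secondCharDegree M) + Nat.card M := by
    positivity
  rcases Y.eq_empty_or_nonempty with hYe | ⟨y₀, hy₀⟩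
  · simpa [hYe] using hRHS
  rcases Z.eq_empty_or_nonempty with hZe | ⟨z₀, hz₀⟩
  · simpa [hZe] using hRHS
  -- translate `Y`, `Z` into `M`
  set Y₁ := Y.image (· * y₀⁻¹) with hY₁
  set Z₁ := Z.image (· * z₀⁻¹) with hZ₁
  have hT₁ : TripleProductProperty X Y₁ Z₁ := by
    have hX1 : X.image (· * (1 : G)) = X := by simp only [mul_one, Finset.image_id']
    have := (tripleProductProperty_image_mul_right_iff X Y Z 1 y₀⁻¹ z₀⁻¹).2 hT
    rwa [hX1] at this
  have hY₁M : ∀ y ∈ Y₁, y ∈ M := by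
    intro y hy
    obtain ⟨y', hy', rfl⟩ := Finset.mem_image.1 hy
    exact hY y' hy' y₀ hy₀
  have hZ₁M : ∀ z ∈ Z₁, z ∈ M := by
    intro z hz
    obtain ⟨z', hz', rfl⟩ := Finset.mem_image.1 hz
    exact hZ z' hz' z₀ hz₀
  have hcY : Y₁.card = Y.card := Finset.card_image_of_injective _ (mul_left_injective _)
  have hcZ : Z₁.card = Z.card := Finset.card_image_of_injective _ (mul_left_injective _)
  -- pull back to `↥M`
  obtain ⟨X', hX'i, hX'c⟩ := subgroupHorn_exists_preimage M X hX
  obtain ⟨Y', hY'i, hY'c⟩ := subgroupHorn_exists_preimage M Y₁ hY₁M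
  obtain ⟨Z', hZ'i, hZ'c⟩ := subgroupHorn_exists_preimage M Z₁ hZ₁M
  have hT' : TripleProductProperty X' Y' Z' := by
    refine slicedHorn_tpp_of_image M.subtype M.subtype_injective ?_
    rw [hX'i, hY'i, hZ'i]; exact hT₁
  have h32 := BCGPU2023_thm32_holds M hna X' Y' Z' hT'
  rw [hX'c, hY'c, hZ'c, hcY, hcZ] at h32
  rw [hcardM]
  exact h32

/-- **Subgroup horns, general `X`.**  As `subgroupHorn_card_mul_le`, with `X` arbitrary and `X ∩ M` in
the bound: `|X ∩ M||Y||Z| ≤ |M|^{3/2}/√n(M) + |M|` (the sub-triple `(X ∩ M, Y, Z)` inherits the TPP).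
[cite: BlasiakCohnGrochowPrattUmans2023, Thm. 3.2] -/
theorem subgroupHorn_card_filter_mul_le {G : Type} [Group G] [Fintype G] [DecidableEq G]
    (M : Subgroup G) [DecidablePred (· ∈ M)] (X Y Z : Finset G) (hT : TripleProductProperty X Y Z)
    (hY : ∀ y ∈ Y, ∀ y' ∈ Y, y * y'⁻¹ ∈ M) (hZ : ∀ z ∈ Z, ∀ z' ∈ Z, z * z'⁻¹ ∈ M)
    (hna : ∃ a b : M, a * b ≠ b * a) :
    (((X.filter (· ∈ M)).card * Y.card * Z.card : ℕ) : ℝ) ≤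
      (Nat.card M : ℝ) ^ (3 / 2 : ℝ) / Real.sqrt (secondCharDegree M) + Nat.card M :=
  subgroupHorn_card_mul_le M (X.filter (· ∈ M)) Y Z
    (hT.mono (Finset.filter_subset _ _) le_rfl le_rfl) (fun _ hx => (Finset.mem_filter.1 hx).2) hY hZ hna

end Summit.MatrixMultiplication.MatrixMultiplication.Theorems.GradedDesignFamily.Negative

end
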